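import Summits.BirchSwinnertonDyer.BirchSwinnertonDyer.Theorems.SignedLowerHalvesSprungLowerDivisibilityAtThreeIotaDoorContraOrbitKato
import Summits.BirchSwinnertonDyer.BirchSwinnertonDyer.Theorems.SignedLowerHalvesSprungLowerDivisibilityAtThreeSqueezeToCommonZerosContra
import Summits.BirchSwinnertonDyer.Rank1Residual.Supersingular.X8PrintDischarge
import Literature.NumberTheory.EllipticCurves.IwasawaAlgebraPromotionProofs
import Literature.NumberTheory.EllipticCurves.IwasawaAlgebraDivisibilityProofs
import Literature.NumberTheory.EllipticCurves.TateModuleBigImageOfSurjectiveProofs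
import Literature.NumberTheory.EllipticCurves.Sprung2012.SharpFlatSelmerTorsionOfContragredientSequenceProofs
import Literature.NumberTheory.EllipticCurves.KatoFineSelmerDualUniquenessProofs
import HarnessLib

/-!
# Sprung 2012 Thm. 7.16 IN PRINT KEYING — Kato's divisibility `(pⁿ·L^•) ⊆ Char X^•(E/ℚ_∞)` for the CONTRAGREDIENT
# (`γ⁻¹`-keyed) ♯/♭ Selmer dual — DERIVED, on class X8 and for every non-CM curve with `E[p]` irreducible and a
# `p`-adic unit period ratio, from Kato 2004 Thm. 13.4 (print-exact), Serre's open image, the held `γ⁻¹`-keyed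
# Coleman–Kato package and the period unit: Sprung's own proof of Thm. 7.16 (p. 1504: sequence (3) + [Ka, Thm. 12.5])

Cell `bsd-ssimc` (host `run/shared/lean/pub/bsd-ssimc/`), width seat `cruxlead-stmt-BirchSwinnertonDyer-19875-w3` (gen 11)
under the LEAD of crux stmt-BirchSwinnertonDyer-19875 `SprungLowerDivisibilityAtThree` (line `chromatic-common-zeros`); twin
route `PrintX8VSC`. `--supports` stmt-BirchSwinnertonDyer-19875 `--as helper`; THEOREMS ONLY (no `def`, no named fact, no
instance); closes NO item.

## What and why

The named fact `Sprung2012.thm716_sharpFlatCharIdeal_divisibility_contra` (Sprung 2012 Thm. 7.16 / Thm. 1.4 read for the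
Pontryagin dual `X^•(E/ℚ_∞)` WITH ITS CONTRAGREDIENT `Λ`-structure, reading flags `Sp12-716-dual-action` / `Sp12-716-period`)
is displayed BY NAME all over the print-keyed X8 routes: aside `InputKatoSharpFlatDivisibilityContra` (item 23537),
conjunct (iv) of `PublishedInputsX8Contra` (item 23741), the second antecedent of the guards of the research cruxes K′
(`KatoFineLowerSporadicGivenHeldX8Contra`, 23732) and C′ (`CyclotomicLowerPosLevelGivenHeldX8Contra`, 23733), and the
binder `h716c` of the rank-zero upper half (`PrintX8VSCSharpFlatKatoUpperHalfContra`). In print, Thm. 7.16 is NOT an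
independent input: Sprung proves it (p. 1504) from the exact sequence (3) of Thm. 7.14's proof and Kato's Thm. 12.5 /
13.4. Both ingredients are in the tree: (3) with the Coleman isomorphism composed in is the field `exact` of the held
`γ⁻¹`-keyed package `SharpFlatColemanKatoDataContra` (named facts `thm714seq_sharpFlatColemanKato_zeta[_Joint]_contra`,
item 23747 / conjunct (iii) of `HeldInputsX8RContra`), whose four-term length identity
`ℓ_𝔭 X^• + ℓ_𝔭(𝐇¹/Z) = ℓ_𝔭 X₀ + ℓ_𝔭 Λ/(G₁)` is LEAD g6's `SharpFlatColemanKatoDataContra.lengthAt_add_eq`; Kato's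
Thm. 13.4 (2)(3) in print-exact keying is `Kato2004.thm13_4_lengthAt_fineSelmerDualContra_le_of_isEulerSystemClass`
(already a displayed item of route `QuadraticBranchSignedControl`), turned into `ℓ_𝔭 X₀ ≤ ℓ_𝔭(𝐇¹/Z)` on the
package by w2 g12's `SharpFlatColemanKatoDataContra.fine_le_zeta_of_thm13_4` (hypothesis (v) from Serre's open image for
a non-CM curve). THIS FILE composes them:

* §1 (package level, any curve): `SharpFlatColemanKatoDataContra.lengthAt_le_quotient_span_of_thm13_4` — at every
  height-one `𝔭 ∌ p`, `ℓ_𝔭 D.X ≤ ℓ_𝔭 Λ/(G₁)` for every `γ⁻¹`-keyed dual datum `D` of `Sel^•(E/ℚ_∞)` and every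
  Néron-normalised `G₁` (`ι G₁ = C(ϖ)·ι L^•`); `…_of_forall_surjective` — the same at EVERY height-one prime when
  `ρ_{E,p^m}` is onto for all `m` (Kato 13.4 (3), the element `σ ↦ (1 1; 0 1)` of
  `exists_quotient_range_galoisRepTate_sub_one_equiv_of_forall_surjective`; no Serre, no `¬CM`);
  `…exists_pow_mul_mem_charIdeal_of_thm13_4` — **`pⁿ·G₁ ∈ char D.X` for some `n`** (the bridge
  `Module.exists_pow_mul_mem_charIdeal_of_lengthAt_le`); `…mem_charIdeal_of_thm13_4_of_forall_surjective` —
  **`G₁ ∈ char D.X`** (μ-promotion `IwasawaAlgebra.le_charIdeal_of_span_p_pow_mul_le_of_lengthAt_le`).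
* §2 `thm716_contra_clauses_of_thm13_4` — BOTH CLAUSES of `thm716_sharpFlatCharIdeal_divisibility_contra` in its own
  binder telescope, for a non-CM curve with `E[p]` irreducible and a period ratio `ϖ` with `‖ϖ‖_p = 1`
  (`G₁ := C(ϖ)·L^•`), from `h134C`, `hSerre` and the one-colour package fact `thm714seq_sharpFlatColemanKato_zeta_contra`.
* §3 **`thm716_contra_onX8_of_thm13_4 (h134C) (hSerre) (hJc) (h3)`: for every X8 pair, the BODY of
  `thm716_sharpFlatCharIdeal_divisibility_contra` at `(W, p)`** — a drop-in for every X8 consumer's `h716c W p …`; the X8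
  discharges are `ClassX8.not_hasCM`, `ClassX8.irr'`, and `‖ϖ‖₃ = 1` from the held period fact at `3` (`h3`, item 19291).

HONEST FRAMING. Nothing is discharged: Kato 13.4, Serre's open image, the `γ⁻¹`-keyed package and the period unit are
PUBLISHED theorems typed statement-only (D-0014: typed ≠ proved); the all-curves named fact
`thm716_sharpFlatCharIdeal_divisibility_contra` itself is NOT proved here (for CM curves hypothesis (v) of Kato's Thm. 13.4
is not available in the tree). What the file changes is the DISPLAYED TRUST BASE of the X8 print routes: on X8 the re-keyed
transcription `thm716_…_contra` is a kernel consequence of {Kato 13.4 print-exact, Serre, package (held), period unit (held)};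
in particular its KEYING is forced by the package's `exact` field (a kernel consistency check of two independently typed
readings of Sprung's p. 1504). No summit statement (`BirchSwinnertonDyer`), no K1, no K′ / C′ / MC′, no X8 cell is proved or
moved by this file.

References: F. Sprung, J. Number Theory 132 (2012) Def. 6.1 (p. 1495), Thm. 7.14 with (3), Thm. 7.16 (p. 1504), Thm. 1.4
(p. 1486), Prop. 7.19 (p. 1505) [Sprung2012]; K. Kato, Astérisque 295 (2004) Thm. 12.5 / 12.6 (p. 222), Thm. 13.4 (p. 226),
§17.13 (pp. 279–280) [Kato2004Asterisque]; J.-P. Serre, *Abelian ℓ-adic representations* (1968) IV-11, IV-23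
[SerreAbelianLadic1968]; L. Washington, GTM 83, §13.2 [Washington1997]; R. Greenberg–V. Vatsal, Invent. Math. 142 (2000) §3
Rem. 3.4 [GreenbergVatsal2000]. Tree: `…SqueezeToCommonZerosContra` (LEAD g6), `…IotaDoorContraOrbitKato` (w2 g12),
`Sprung2012/SharpFlatSelmerTorsionOfContragredientSequenceProofs` (the sibling derivation of Thm. 7.14 from the package),
`IwasawaAlgebraDivisibilityProofs`, `IwasawaAlgebraPromotionProofs`, `TateModuleBigImageOfSurjectiveProofs`.
-/

set_option linter.dupNamespace false
set_option autoImplicit false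

noncomputable section

open scoped Classical NumberField MatrixGroups ModularForm

open NumberField IsDedekindDomain CongruenceSubgroup WeierstrassCurve Field
  Literature.NumberTheory.EllipticCurves Literature.NumberTheory.EllipticCurves.ModularForms
  Literature.NumberTheory.EllipticCurves.ZpExtension Literature.NumberTheory.EllipticCurves.Sprung2017
  Literature.NumberTheory.EllipticCurves.Sprung2012 Literature.NumberTheory.EllipticCurves.Rank1Residual
  Literature.NumberTheory.EllipticCurves.IwasawaAlgebra Literature.NumberTheory.EllipticCurves.Kato2004
  Literature.NumberTheory.EllipticCurves.Module
  Summit.BirchSwinnertonDyer.BirchSwinnertonDyer.Theorems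
  Summit.BirchSwinnertonDyer.Rank1Residual.Supersingular

namespace Summit.BirchSwinnertonDyer.BirchSwinnertonDyer.Theorems.ChromaticCommonZeros

/-! ### §1 Package level: `ℓ_𝔭 X^•(γ⁻¹) ≤ ℓ_𝔭 Λ/(G₁)` and the two clauses of Thm. 7.16 for a normalised generator -/

section Package

variable (W : WeierstrassCurve ℚ) [W.IsElliptic] (p : ℕ) [Fact p.Prime]
  [ContinuousSMul ℤ_[p] (W.tateModule p)] [Module.Free ℤ_[p] (W.tateModule p)]
  [Module.Finite ℤ_[p] (W.tateModule p)]
  {N : ℕ} {f : CuspForm (Gamma0 N) 2} {ϖ : ℚ} {κ : ZpExtension ℚ p} {γ : absoluteGaloisGroup ℚ}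
  {E : Type} [Field E] [Algebra ℚ E] {ι : AlgebraicClosure ℚ →ₐ[ℚ] AlgebraicClosure E} {ap : ℤ}
  {g : absoluteGaloisGroup E} {c : ℕ → localPoints W E} {I : IwasawaH1Data W p κ γ}

/-- **`ℓ_𝔭 X^•(γ⁻¹) ≤ ℓ_𝔭 Λ/(G₁)` off `(p)` — Sprung's Thm. 7.16 prime by prime, from Kato 13.4 (2).** For a print-keyed
♯/♭ package `C` of colour `•` on a pinned `I` over the cyclotomic `(κ, γ)` (`p` odd, `E` non-CM, `E[p]` irreducible,
`L^• ≠ 0`, Néron-normalised `G₁ ≠ 0`) and EVERY `γ⁻¹`-keyed dual datum `D` of `Sel^•(E/ℚ_∞)`: at every height-one `𝔭 ∌ p`,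
`ℓ_𝔭 D.X ≤ ℓ_𝔭 Λ/(G₁)`. Proof: the four-term identity `ℓ_𝔭 D.X + ℓ_𝔭(I.H/Z) = ℓ_𝔭 X₀ + ℓ_𝔭 Λ/(G₁)` (`lengthAt_add_eq`,
any `γ⁻¹`-keyed fine datum `X₀`, which exists: `nonempty_fineSelmerDualData'`) and Kato's `ℓ_𝔭 X₀ ≤ ℓ_𝔭(I.H/Z)`
(`fine_le_zeta_of_thm13_4`), the zeta index being finite. CONDITIONAL on `h134C`, `hSerre` (displayed).
[cite: Sprung2012, Thm. 7.14 (3) and Thm. 7.16 (p. 1504)] [cite: Kato2004Asterisque, Thm. 13.4 (2) (p. 226), §17.13 (p. 280)] -/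
theorem _root_.Literature.NumberTheory.EllipticCurves.Sprung2012.SharpFlatColemanKatoDataContra.lengthAt_le_quotient_span_of_thm13_4
    (h134C : thm13_4_lengthAt_fineSelmerDualContra_le_of_isEulerSystemClass)
    (hSerre : serre_adicImage_contains_congruenceSubgroup)
    {col : Chroma} (C : SharpFlatColemanKatoDataContra W p f ϖ κ γ ι ap g c col I)
    (hp : p ≠ 2) (hκ : κ.IsCyclotomic) (hγ : κ.IsTopGenerator γ) (hCM : ¬ W.HasCM)
    (hirr : W.HasIrreducibleModPGaloisRep p) {Lsharp Lflat G₁ : IwasawaAlgebra p}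
    (hSP : IsSprungPair f p ap Lsharp Lflat) (hcol : chromaticL col Lsharp Lflat ≠ 0)
    (hG₁ : iwasawaToPowerSeries p G₁ =
      PowerSeries.C ((ϖ : ℚ) : ℚ_[p]) * iwasawaToPowerSeries p (chromaticL col Lsharp Lflat))
    (hG0 : G₁ ≠ 0) (D : SharpFlatSelmerDualData W κ γ⁻¹ ι ap g c col)
    (𝔭 : PrimeSpectrum (IwasawaAlgebra p)) (h𝔭 : 𝔭.asIdeal.height = 1)
    (hp𝔭 : (p : IwasawaAlgebra p) ∉ 𝔭.asIdeal) :
    Module.lengthAt (IwasawaAlgebra p) D.X 𝔭 ≤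
      Module.lengthAt (IwasawaAlgebra p) (IwasawaAlgebra p ⧸ Ideal.span {G₁}) 𝔭 := by
  obtain ⟨Y⟩ := W.nonempty_fineSelmerDualData' κ γ⁻¹
  have h4 := C.lengthAt_add_eq W p hirr hSP hcol hG₁ D Y 𝔭 h𝔭
  have hK := C.fine_le_zeta_of_thm13_4 W p h134C hSerre hp hκ hγ hCM hirr hSP hcol hG₁ hG0 Y 𝔭 h𝔭 hp𝔭
  have hk := C.lengthAt_quotient_zeta_ne_top W p hirr hSP hcol hG₁ hG0 𝔭 h𝔭
  have hle : Module.lengthAt (IwasawaAlgebra p) D.X 𝔭 + Module.lengthAt (IwasawaAlgebra p) (I.H ⧸ C.Z) 𝔭 ≤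
      Module.lengthAt (IwasawaAlgebra p) (IwasawaAlgebra p ⧸ Ideal.span {G₁}) 𝔭 +
        Module.lengthAt (IwasawaAlgebra p) (I.H ⧸ C.Z) 𝔭 := by
    rw [h4, add_comm]
    gcongr
  exact (ENat.addLECancellable_of_ne_top hk).add_le_add_iff_right.mp hle

/-- **Kato 13.4 (3) on the contragredient package, at EVERY height-one prime, under `p`-adic surjectivity.** Same package
data (`E[p]` irreducible, `L^• ≠ 0`, `G₁ ≠ 0` normalised), NO Serre / `¬CM`: if `ρ̄_{E,p^m}` is onto for every `m`, then
for every `γ⁻¹`-keyed fine datum `Y′` and every height-one `𝔭` (also `𝔭 = (p)`), `ℓ_𝔭 Y′.X ≤ ℓ_𝔭(I.H ⧸ C.Z)`. The element `σ`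
of Kato's hypothesis is `(1 1; 0 1)` (`exists_quotient_range_galoisRepTate_sub_one_equiv_of_forall_surjective`); it also
serves as hypothesis (v). CONDITIONAL on `h134C`. [cite: Kato2004Asterisque, Thm. 12.5 (4) with (12.5.2) (p. 222), Thm. 13.4 (3) (p. 226)]
[cite: SerreAbelianLadic1968, IV-23 Lemma 3] [cite: Sprung2012, Thm. 1.4 (p. 1486)] -/
theorem _root_.Literature.NumberTheory.EllipticCurves.Sprung2012.SharpFlatColemanKatoDataContra.fine_le_zeta_of_thm13_4_of_forall_surjective
    (h134C : thm13_4_lengthAt_fineSelmerDualContra_le_of_isEulerSystemClass)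
    {col : Chroma} (C : SharpFlatColemanKatoDataContra W p f ϖ κ γ ι ap g c col I)
    (hp : p ≠ 2) (hκ : κ.IsCyclotomic) (hγ : κ.IsTopGenerator γ)
    (hirr : W.HasIrreducibleModPGaloisRep p) {Lsharp Lflat G₁ : IwasawaAlgebra p}
    (hSP : IsSprungPair f p ap Lsharp Lflat) (hcol : chromaticL col Lsharp Lflat ≠ 0)
    (hG₁ : iwasawaToPowerSeries p G₁ =
      PowerSeries.C ((ϖ : ℚ) : ℚ_[p]) * iwasawaToPowerSeries p (chromaticL col Lsharp Lflat))
    (hG0 : G₁ ≠ 0) (hsurj : ∀ m : ℕ, W.HasSurjectiveModNGaloisRep (p ^ m : ℕ))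
    (Y : W.FineSelmerDualData κ γ⁻¹)
    (𝔭 : PrimeSpectrum (IwasawaAlgebra p)) (h𝔭 : 𝔭.asIdeal.height = 1) :
    Module.lengthAt (IwasawaAlgebra p) Y.X 𝔭 ≤ Module.lengthAt (IwasawaAlgebra p) (I.H ⧸ C.Z) 𝔭 := by
  obtain ⟨s, hsES, hs0, hle⟩ := C.exists_isEulerSystemClass_lengthAt_quotient_le_zeta W p hirr hSP hcol hG₁ hG0 𝔭 h𝔭
  obtain ⟨σ, hσ, ⟨e⟩⟩ :=
    WeierstrassCurve.exists_quotient_range_galoisRepTate_sub_one_equiv_of_forall_surjective W p hsurj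
  have hV : ∃ σ : absoluteGaloisGroup ℚ,
      (∀ (n : ℕ) (t : AlgebraicClosure ℚ), t ^ p ^ n = 1 → σ • t = t) ∧
        Module.finrank ℤ_[p] ((W.tateModule p) ⧸ LinearMap.range (W.galoisRepTate p σ - 1)) = 1 :=
    ⟨σ, hσ, by rw [e.finrank_eq, Module.finrank_self]⟩
  exact ((h134C W p κ γ hp hκ hγ I Y s hsES hs0 hV).2 hirr ⟨σ, hσ, ⟨e⟩⟩ 𝔭 h𝔭).trans hle

/-- **`ℓ_𝔭 X^•(γ⁻¹) ≤ ℓ_𝔭 Λ/(G₁)` at EVERY height-one prime under `p`-adic surjectivity** (also at `𝔭 = (p)`: the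
`μ`-part of Thm. 1.4). Same data, NO Serre / `¬CM`. CONDITIONAL on `h134C`.
[cite: Sprung2012, Thm. 1.4 (p. 1486), Thm. 7.16 (p. 1504)] [cite: Kato2004Asterisque, Thm. 13.4 (3) (p. 226), §17.13 (p. 280)] -/
theorem _root_.Literature.NumberTheory.EllipticCurves.Sprung2012.SharpFlatColemanKatoDataContra.lengthAt_le_quotient_span_of_thm13_4_of_forall_surjective
    (h134C : thm13_4_lengthAt_fineSelmerDualContra_le_of_isEulerSystemClass)
    {col : Chroma} (C : SharpFlatColemanKatoDataContra W p f ϖ κ γ ι ap g c col I)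
    (hp : p ≠ 2) (hκ : κ.IsCyclotomic) (hγ : κ.IsTopGenerator γ)
    (hirr : W.HasIrreducibleModPGaloisRep p) {Lsharp Lflat G₁ : IwasawaAlgebra p}
    (hSP : IsSprungPair f p ap Lsharp Lflat) (hcol : chromaticL col Lsharp Lflat ≠ 0)
    (hG₁ : iwasawaToPowerSeries p G₁ =
      PowerSeries.C ((ϖ : ℚ) : ℚ_[p]) * iwasawaToPowerSeries p (chromaticL col Lsharp Lflat))
    (hG0 : G₁ ≠ 0) (hsurj : ∀ m : ℕ, W.HasSurjectiveModNGaloisRep (p ^ m : ℕ))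
    (D : SharpFlatSelmerDualData W κ γ⁻¹ ι ap g c col)
    (𝔭 : PrimeSpectrum (IwasawaAlgebra p)) (h𝔭 : 𝔭.asIdeal.height = 1) :
    Module.lengthAt (IwasawaAlgebra p) D.X 𝔭 ≤
      Module.lengthAt (IwasawaAlgebra p) (IwasawaAlgebra p ⧸ Ideal.span {G₁}) 𝔭 := by
  obtain ⟨Y⟩ := W.nonempty_fineSelmerDualData' κ γ⁻¹
  have h4 := C.lengthAt_add_eq W p hirr hSP hcol hG₁ D Y 𝔭 h𝔭
  have hK := C.fine_le_zeta_of_thm13_4_of_forall_surjective W p h134C hp hκ hγ hirr hSP hcol hG₁ hG0 hsurj Y 𝔭 h𝔭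
  have hk := C.lengthAt_quotient_zeta_ne_top W p hirr hSP hcol hG₁ hG0 𝔭 h𝔭
  have hle : Module.lengthAt (IwasawaAlgebra p) D.X 𝔭 + Module.lengthAt (IwasawaAlgebra p) (I.H ⧸ C.Z) 𝔭 ≤
      Module.lengthAt (IwasawaAlgebra p) (IwasawaAlgebra p ⧸ Ideal.span {G₁}) 𝔭 +
        Module.lengthAt (IwasawaAlgebra p) (I.H ⧸ C.Z) 𝔭 := by
    rw [h4, add_comm]
    gcongr
  exact (ENat.addLECancellable_of_ne_top hk).add_le_add_iff_right.mp hle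

/-- **Thm. 7.16, RATIONAL clause, for a normalised generator: `pⁿ·G₁ ∈ char X^•(γ⁻¹)` for some `n`** — from
`lengthAt_le_quotient_span_of_thm13_4` by the bridge `Module.exists_pow_mul_mem_charIdeal_of_lengthAt_le` (`Λ` a Noetherian UFD,
`p ∈ Λ` prime). Same data, `D.X` finitely generated torsion (as in Thm. 7.16's statement). CONDITIONAL on `h134C`, `hSerre`.
[cite: Sprung2012, Thm. 7.16 (p. 1504)] [cite: Kato2004Asterisque, Thm. 13.4 (2) (p. 226)] [cite: Washington1997, §13.2] -/
theorem _root_.Literature.NumberTheory.EllipticCurves.Sprung2012.SharpFlatColemanKatoDataContra.exists_pow_mul_mem_charIdeal_of_thm13_4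
    (h134C : thm13_4_lengthAt_fineSelmerDualContra_le_of_isEulerSystemClass)
    (hSerre : serre_adicImage_contains_congruenceSubgroup)
    {col : Chroma} (C : SharpFlatColemanKatoDataContra W p f ϖ κ γ ι ap g c col I)
    (hp : p ≠ 2) (hκ : κ.IsCyclotomic) (hγ : κ.IsTopGenerator γ) (hCM : ¬ W.HasCM)
    (hirr : W.HasIrreducibleModPGaloisRep p) {Lsharp Lflat G₁ : IwasawaAlgebra p}
    (hSP : IsSprungPair f p ap Lsharp Lflat) (hcol : chromaticL col Lsharp Lflat ≠ 0)
    (hG₁ : iwasawaToPowerSeries p G₁ =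
      PowerSeries.C ((ϖ : ℚ) : ℚ_[p]) * iwasawaToPowerSeries p (chromaticL col Lsharp Lflat))
    (hG0 : G₁ ≠ 0) (D : SharpFlatSelmerDualData W κ γ⁻¹ ι ap g c col)
    [Module.Finite (IwasawaAlgebra p) D.X] (hD : Module.IsTorsion (IwasawaAlgebra p) D.X) :
    ∃ n : ℕ, (p : IwasawaAlgebra p) ^ n * G₁ ∈ D.charIdeal :=
  Module.exists_pow_mul_mem_charIdeal_of_lengthAt_le hD prime_natCast hG0 fun 𝔭 h𝔭 hp𝔭 =>
    C.lengthAt_le_quotient_span_of_thm13_4 W p h134C hSerre hp hκ hγ hCM hirr hSP hcol hG₁ hG0 D 𝔭 h𝔭 hp𝔭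

/-- **Thm. 7.16 / Thm. 1.4, INTEGRAL clause, for a normalised generator: `G₁ ∈ char X^•(γ⁻¹)` when `ρ̄_{E,p^m}` is onto for
every `m`.** From the rational clause (`h134C` (2), Serre) and the length inequality at `(p)` (`h134C` (3):
`μ(X^•) ≤ ord_p G₁`), promoted by `IwasawaAlgebra.le_charIdeal_of_span_p_pow_mul_le_of_lengthAt_le`. CONDITIONAL on `h134C`,
`hSerre`. [cite: Sprung2012, Thm. 1.4 (p. 1486), Thm. 7.16 (p. 1504)] [cite: Kato2004Asterisque, Thm. 13.4 (2)(3) (p. 226)]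
[cite: Washington1997, §13.2] -/
theorem _root_.Literature.NumberTheory.EllipticCurves.Sprung2012.SharpFlatColemanKatoDataContra.mem_charIdeal_of_thm13_4_of_forall_surjective
    (h134C : thm13_4_lengthAt_fineSelmerDualContra_le_of_isEulerSystemClass)
    (hSerre : serre_adicImage_contains_congruenceSubgroup)
    {col : Chroma} (C : SharpFlatColemanKatoDataContra W p f ϖ κ γ ι ap g c col I)
    (hp : p ≠ 2) (hκ : κ.IsCyclotomic) (hγ : κ.IsTopGenerator γ) (hCM : ¬ W.HasCM)
    (hirr : W.HasIrreducibleModPGaloisRep p) {Lsharp Lflat G₁ : IwasawaAlgebra p}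
    (hSP : IsSprungPair f p ap Lsharp Lflat) (hcol : chromaticL col Lsharp Lflat ≠ 0)
    (hG₁ : iwasawaToPowerSeries p G₁ =
      PowerSeries.C ((ϖ : ℚ) : ℚ_[p]) * iwasawaToPowerSeries p (chromaticL col Lsharp Lflat))
    (hG0 : G₁ ≠ 0) (hsurj : ∀ m : ℕ, W.HasSurjectiveModNGaloisRep (p ^ m : ℕ))
    (D : SharpFlatSelmerDualData W κ γ⁻¹ ι ap g c col)
    [Module.Finite (IwasawaAlgebra p) D.X] (hD : Module.IsTorsion (IwasawaAlgebra p) D.X) :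
    G₁ ∈ D.charIdeal := by
  obtain ⟨n, hn⟩ := C.exists_pow_mul_mem_charIdeal_of_thm13_4 W p h134C hSerre hp hκ hγ hCM hirr hSP hcol hG₁ hG0 D hD
  have hP : Prime (p : IwasawaAlgebra p) := prime_natCast
  -- the height-one prime `(p)` and the exponent `e = ord_p G₁`
  haveI hPI : (Ideal.span {(p : IwasawaAlgebra p)}).IsPrime := (Ideal.span_singleton_prime hP.ne_zero).mpr hP
  let 𝔮 : PrimeSpectrum (IwasawaAlgebra p) := ⟨Ideal.span {(p : IwasawaAlgebra p)}, hPI⟩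
  have h𝔮 : 𝔮.asIdeal.height = 1 := height_span_singleton_eq_one_of_prime hP
  have hfin : Module.lengthAt (IwasawaAlgebra p) (IwasawaAlgebra p ⧸ Ideal.span {G₁}) 𝔮 ≠ ⊤ :=
    lengthAt_ne_top_of_isTorsionBy hG0 (isTorsionBy_quotient_span_singleton G₁) 𝔮 (le_of_eq h𝔮)
  set e : ℕ := (Module.lengthAt (IwasawaAlgebra p) (IwasawaAlgebra p ⧸ Ideal.span {G₁}) 𝔮).toNat with he
  have hecoe : (e : ℕ∞) = Module.lengthAt (IwasawaAlgebra p) (IwasawaAlgebra p ⧸ Ideal.span {G₁}) 𝔮 :=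
    ENat.coe_toNat hfin
  -- `μ(D.X) ≤ e`
  have hμ : ∀ 𝔭 : PrimeSpectrum (IwasawaAlgebra p), 𝔭.asIdeal = Ideal.span {(p : IwasawaAlgebra p)} →
      Module.lengthAt (IwasawaAlgebra p) D.X 𝔭 ≤ e := by
    intro 𝔭 h𝔭e
    have h𝔭𝔮 : 𝔭 = 𝔮 := PrimeSpectrum.ext h𝔭e
    rw [h𝔭𝔮, hecoe]
    exact C.lengthAt_le_quotient_span_of_thm13_4_of_forall_surjective W p h134C hp hκ hγ hirr hSP hcol hG₁ hG0
      hsurj D 𝔮 h𝔮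
  -- `(G₁) ⊆ (p ^ e)`
  have hA : Ideal.span {G₁} ≤ Ideal.span {(p : IwasawaAlgebra p) ^ e} :=
    Ideal.span_singleton_le_span_singleton.mpr
      (pow_dvd_of_le_lengthAt_quotient hP hG0 𝔮 rfl (le_of_eq hecoe))
  -- `(p ^ n) · (G₁) ⊆ char`
  have hmul : Ideal.span {(p : IwasawaAlgebra p) ^ n} * Ideal.span {G₁} ≤
      Module.charIdeal (IwasawaAlgebra p) D.X := by
    rw [Ideal.span_singleton_mul_span_singleton, Ideal.span_singleton_le_iff_mem]
    exact hn
  exact le_charIdeal_of_span_p_pow_mul_le_of_lengthAt_le hD hμ hA hmul (Ideal.mem_span_singleton_self G₁)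

end Package

/-! ### §2 The two clauses of `thm716_sharpFlatCharIdeal_divisibility_contra` in its own binder telescope -/

/-- **SPRUNG 2012 THM. 7.16 IN PRINT KEYING, BOTH CLAUSES, DERIVED** — for a non-CM curve with `E[p]` irreducible and a period
ratio `ϖ` (`ϖ·Ω_E = Ω⁺_f`) that is a `p`-adic unit. In the binder telescope of the named fact
`thm716_sharpFlatCharIdeal_divisibility_contra` (`W/ℚ` globally minimal, `p ≠ 2` good with `p ∣ a_p`, newform `f`, cyclotomic
`(κ, γ)`, the place `v ∣ p`, local lift `g`, Honda system `(cneg, c)`, colour `•` with `L^• ≠ 0`, a `γ⁻¹`-keyed dual datum `D`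
of `Sel^•(E/ℚ_∞)`, finitely generated `Λ`-torsion): **(a) `pⁿ·L^• ∈ Char X^•` for some `n`; (b) `L^• ∈ Char X^•` if every
`ρ̄_{E,p^m}` is onto.** Inputs BY NAME: Kato 13.4 print-exact (`h134C`), Serre's open image (`hSerre`, clause (a)), the
one-colour `γ⁻¹`-keyed package fact (`hCKc`); Kato's `𝐇¹` datum from `Kato2004.nonempty_iwasawaH1Data_holds` (PROVED); the
normalised generator is `G₁ := C(ϖ)·L^•` (`‖ϖ‖_p = 1`). This is Sprung's printed proof of Thm. 7.16 ((3) + [Ka, Thm. 12.5]),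
kernel-checked on the tree's transcriptions. [cite: Sprung2012, Thm. 7.16 (p. 1504), Thm. 1.4 (p. 1486), Def. 6.1 (p. 1495)]
[cite: Kato2004Asterisque, Thm. 12.5 (p. 222), Thm. 13.4 (p. 226)] [cite: SerreAbelianLadic1968, IV-11] -/
theorem thm716_contra_clauses_of_thm13_4
    (h134C : thm13_4_lengthAt_fineSelmerDualContra_le_of_isEulerSystemClass)
    (hSerre : serre_adicImage_contains_congruenceSubgroup)
    (hCKc : thm714seq_sharpFlatColemanKato_zeta_contra)
    (W : WeierstrassCurve ℚ) [W.IsElliptic] [W.IsGloballyMinimal] (p : ℕ) [Fact p.Prime]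
    (hp : p ≠ 2) (hgood : W.HasGoodReductionAtPrime p) (hss : (p : ℤ) ∣ W.frobeniusTrace p)
    (hCM : ¬ W.HasCM) (hirr : W.HasIrreducibleModPGaloisRep p)
    {N : ℕ} [NeZero N] (f : CuspForm (Gamma0 N) 2) (hf : IsNewformOf W f)
    (ϖ : ℚ) (hϖ : (ϖ : ℝ) * W.realPeriodRat = plusPeriod f) (hϖ1 : ‖((ϖ : ℚ) : ℚ_[p])‖ = 1)
    (κ : ZpExtension ℚ p) (γ : Field.absoluteGaloisGroup ℚ)
    (hκ : κ.IsCyclotomic) (hγ : κ.IsTopGenerator γ) (hγ' : IsCyclotomicVariable p γ)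
    (v : HeightOneSpectrum (𝓞 ℚ)) (hv : (p : 𝓞 ℚ) ∈ v.asIdeal)
    (g : Field.absoluteGaloisGroup (v.adicCompletion ℚ))
    (hg : κ.IsTopGenerator (resGalOfEmb (closureEmb (K := ℚ) (v.adicCompletion ℚ)) g))
    (cneg : localPoints W (v.adicCompletion ℚ)) (c : ℕ → localPoints W (v.adicCompletion ℚ))
    (hH : IsHondaSystem κ (closureEmb (K := ℚ) (v.adicCompletion ℚ)) W (W.frobeniusTrace p) g cneg c)
    (col : Chroma) (Lsharp Lflat : IwasawaAlgebra p)
    (hSP : IsSprungPair f p (W.frobeniusTrace p) Lsharp Lflat) (hL0 : chromaticL col Lsharp Lflat ≠ 0)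
    (D : SharpFlatSelmerDualData W κ γ⁻¹ (closureEmb (K := ℚ) (v.adicCompletion ℚ))
      (W.frobeniusTrace p) g c col) [Module.Finite (IwasawaAlgebra p) D.X]
    (hD : Module.IsTorsion (IwasawaAlgebra p) D.X) :
    (∃ n : ℕ, (p : IwasawaAlgebra p) ^ n * chromaticL col Lsharp Lflat ∈ D.charIdeal) ∧
      ((∀ m : ℕ, W.HasSurjectiveModNGaloisRep (p ^ m : ℕ)) →
        chromaticL col Lsharp Lflat ∈ D.charIdeal) := by
  haveI : ContinuousSMul ℤ_[p] (W.tateModule p) := TateModule.continuousSMul_padicInt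
  haveI : Module.Free ℤ_[p] (W.tateModule p) := W.module_free_tateModule_holds p
  haveI : Module.Finite ℤ_[p] (W.tateModule p) := W.module_finite_tateModule_holds p
  obtain ⟨I⟩ := Kato2004.nonempty_iwasawaH1Data_holds W p κ γ hκ hγ
  obtain ⟨C⟩ := hCKc W p f ϖ κ γ hp hgood hss hf hϖ hκ hγ hγ' v hv g hg cneg c hH col I
  -- the normalised generator `G₁ = C(ϖ) · L^•`, `ϖ ∈ ℤ_pˣ`
  set a : ℤ_[p] := ⟨((ϖ : ℚ) : ℚ_[p]), hϖ1.le⟩ with ha_def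
  have ha : IsUnit a := PadicInt.isUnit_iff.mpr hϖ1
  have hcoe : (a : ℚ_[p]) = ((ϖ : ℚ) : ℚ_[p]) := rfl
  set G₁ : IwasawaAlgebra p := PowerSeries.C a * chromaticL col Lsharp Lflat with hG₁_def
  have hG₁ : iwasawaToPowerSeries p G₁ =
      PowerSeries.C ((ϖ : ℚ) : ℚ_[p]) * iwasawaToPowerSeries p (chromaticL col Lsharp Lflat) := by
    rw [hG₁_def, iwasawaToPowerSeries_C_mul, hcoe]
  obtain ⟨u, hu⟩ := (PowerSeries.C (R := ℤ_[p])).isUnit_map ha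
  have hG0 : G₁ ≠ 0 := by
    rw [hG₁_def, ← hu]
    exact mul_ne_zero u.ne_zero hL0
  -- `L^• = u⁻¹ · G₁`
  have hLG : chromaticL col Lsharp Lflat = ↑u⁻¹ * G₁ := by
    rw [hG₁_def, ← hu, Units.inv_mul_cancel_left]
  refine ⟨?_, fun hsurj => ?_⟩
  · obtain ⟨n, hn⟩ := C.exists_pow_mul_mem_charIdeal_of_thm13_4 W p h134C hSerre hp hκ hγ hCM hirr hSP hL0 hG₁
      hG0 D hD
    refine ⟨n, ?_⟩
    rw [hLG, mul_left_comm]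
    exact Ideal.mul_mem_left _ _ hn
  · have h := C.mem_charIdeal_of_thm13_4_of_forall_surjective W p h134C hSerre hp hκ hγ hCM hirr hSP hL0 hG₁ hG0
      hsurj D hD
    rw [hLG]
    exact Ideal.mul_mem_left _ _ h

/-! ### §3 On class X8: the body of `thm716_sharpFlatCharIdeal_divisibility_contra`, from four displayed facts -/

/-- **SPRUNG 2012 THM. 7.16 (PRINT KEYING) ON CLASS X8 IS A KERNEL CONSEQUENCE OF {KATO 13.4, SERRE, THE HELD `γ⁻¹`-KEYED
JOINT PACKAGE, THE HELD PERIOD UNIT AT 3}.** For every X8 pair `(W, 3)` (good supersingular `3`, `a₃ = ±3`): the BODY of the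
named fact `thm716_sharpFlatCharIdeal_divisibility_contra` at `(W, p)` — VERBATIM its binder telescope from `p ≠ 2` on, and
both clauses (a) `∃ n, pⁿ·L^• ∈ Char X^•(γ⁻¹)`, (b) `(∀ m, ρ̄_{E,p^m} onto) → L^• ∈ Char X^•(γ⁻¹)`. A drop-in for `h716c W p`
in every X8 consumer (the K′/C′ guards, `PublishedInputsX8Contra` (iv), `PrintX8VSCSharpFlatKatoUpperHalfContra`). X8
discharges: `ClassX8.not_hasCM` (Serre applies), `ClassX8.irr'` (`E[3]` irreducible), and the period ratio: the held fact at
`3` (`h3`, item 19291) gives `Ω_E = u·Ω⁺_f` with `‖u‖₃ = 1`, so `ϖ := u⁻¹` is a `3`-adic unit with `ϖ·Ω_E = Ω⁺_f`. Inputs BY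
NAME: `h134C` (Kato 13.4 print-exact), `hSerre`, `hJc = thm714seq_sharpFlatColemanKato_zetaJoint_contra` (item 23747; one
colour is used, `…_of_joint`), `h3`. HONEST FRAMING: conditional on these four published facts (typed ≠ proved); the
all-curves named fact is NOT discharged; BSD / K′ / C′ / MC′ are not proved. [cite: Sprung2012, Thm. 7.16 (p. 1504), Thm. 1.4
(p. 1486), Thm. 7.14 (3) (p. 1504)] [cite: Kato2004Asterisque, Thm. 12.5 (p. 222), Thm. 13.4 (p. 226)]
[cite: GreenbergVatsal2000, §3 Rem. 3.4] [cite: SerreAbelianLadic1968, IV-11] -/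
theorem thm716_contra_onX8_of_thm13_4
    (h134C : thm13_4_lengthAt_fineSelmerDualContra_le_of_isEulerSystemClass)
    (hSerre : serre_adicImage_contains_congruenceSubgroup)
    (hJc : thm714seq_sharpFlatColemanKato_zetaJoint_contra)
    (h3 : realPeriodRat_eq_unit_mul_plusPeriod_three) :
    ∀ (W : WeierstrassCurve ℚ) [W.IsElliptic] [W.IsGloballyMinimal] (p : ℕ) [Fact p.Prime],
      ClassX8 W p →
      p ≠ 2 → W.HasGoodReductionAtPrime p → (p : ℤ) ∣ W.frobeniusTrace p →
    ∀ {N : ℕ} [NeZero N] (f : CuspForm (Gamma0 N) 2), IsNewformOf W f →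
    ∀ (κ : ZpExtension ℚ p) (γ : Field.absoluteGaloisGroup ℚ),
      κ.IsCyclotomic → κ.IsTopGenerator γ → IsCyclotomicVariable p γ →
    ∀ (v : HeightOneSpectrum (𝓞 ℚ)), (p : 𝓞 ℚ) ∈ v.asIdeal →
    ∀ (g : Field.absoluteGaloisGroup (v.adicCompletion ℚ)),
      κ.IsTopGenerator (resGalOfEmb (closureEmb (K := ℚ) (v.adicCompletion ℚ)) g) →
    ∀ (cneg : localPoints W (v.adicCompletion ℚ)) (c : ℕ → localPoints W (v.adicCompletion ℚ)),
      IsHondaSystem κ (closureEmb (K := ℚ) (v.adicCompletion ℚ)) W (W.frobeniusTrace p) g cneg c →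
    ∀ (col : Chroma) (Lsharp Lflat : IwasawaAlgebra p),
      IsSprungPair f p (W.frobeniusTrace p) Lsharp Lflat → chromaticL col Lsharp Lflat ≠ 0 →
    ∀ (D : SharpFlatSelmerDualData W κ γ⁻¹ (closureEmb (K := ℚ) (v.adicCompletion ℚ))
        (W.frobeniusTrace p) g c col) [Module.Finite (IwasawaAlgebra p) D.X],
      Module.IsTorsion (IwasawaAlgebra p) D.X →
      (∃ n : ℕ, (p : IwasawaAlgebra p) ^ n * chromaticL col Lsharp Lflat ∈ D.charIdeal) ∧
      ((∀ m : ℕ, W.HasSurjectiveModNGaloisRep (p ^ m : ℕ)) →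
        chromaticL col Lsharp Lflat ∈ D.charIdeal) := by
  intro W _ _ p _ hX hp hgood hss N _ f hf κ γ hκ hγ hγ' v hv g hg cneg c hH col Lsharp Lflat hSP hL0 D _ hD
  have hp3 : p = 3 := hX.1
  subst hp3
  -- the period ratio from the held fact at `3`
  obtain ⟨u, hu, hΩ⟩ := h3 W hgood (ClassX8.irr W 3 hX) f hf
  have hu0 : u ≠ 0 := by
    rintro rfl
    rw [Rat.cast_zero, norm_zero] at hu
    exact zero_ne_one hu
  have hϖ : ((u⁻¹ : ℚ) : ℝ) * W.realPeriodRat = plusPeriod f := by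
    rw [hΩ, Rat.cast_inv, ← mul_assoc, inv_mul_cancel₀ (by exact_mod_cast hu0 : (u : ℝ) ≠ 0), one_mul]
  have hϖ1 : ‖((u⁻¹ : ℚ) : ℚ_[3])‖ = 1 := by
    rw [Rat.cast_inv, norm_inv, hu, inv_one]
  exact thm716_contra_clauses_of_thm13_4 h134C hSerre (thm714seq_sharpFlatColemanKato_zeta_contra_of_joint hJc)
    W 3 hp hgood hss (ClassX8.not_hasCM W 3 hX) (ClassX8.irr' W 3 hX) f hf u⁻¹ hϖ hϖ1 κ γ hκ hγ hγ' v hv g hg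
    cneg c hH col Lsharp Lflat hSP hL0 D hD

end Summit.BirchSwinnertonDyer.BirchSwinnertonDyer.Theorems.ChromaticCommonZeros

end
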